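import Mathlib
import HarnessLib
import Summits.NavierStokesRegularity.NavierStokesRegularity.Theorems.ChiralWindowDoorDefs
import Summits.NavierStokesRegularity.NavierStokesRegularity.Theorems.ChiralWindowDoorProfileRigidityOfStubs
import Summits.NavierStokesRegularity.NavierStokesRegularity.Theorems.ChiralWindowDoorLocalHelicityLower
import Summits.NavierStokesRegularity.NavierStokesRegularity.Theorems.ChiralWindowDoorLocalDissipationLower
import Summits.NavierStokesRegularity.NavierStokesRegularity.Theorems.ChiralWindowDoorEssLocalClass
import Summits.NavierStokesRegularity.NavierStokesRegularity.Theorems.ChiralWindowDoorBinderFree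
import Summits.NavierStokesRegularity.NavierStokesRegularity.Theorems.ChiralWindowDoorK1BinderFree
import Summits.NavierStokesRegularity.NavierStokesRegularity.Theorems.ChiralWindowDoorSobolevFatou
import Summits.NavierStokesRegularity.NavierStokesRegularity.Theorems.ChiralWindowDoorHelicityBudget

/-!
# Door S20 «ChiralWindowDoor» — THE RESIDUE LIOUVILLE `HomochiralProfileRigidity` PROVED OUTRIGHT:
# homochiral Type-I ancient mild profiles are not backward-singular; K2 and the door FROM the one analytic input

Door S20 of nsreg-p1's local Type-I door family (`HOME/ns-regularity-ideate-p1/r19/R19-LINE.md`, texts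
`r19/Sketch20v5.lean` 7f13084196f4f031 (with the R19 binder) and `r19/Sketch20v6.lean` (binder-free);
DESIGN-ONLY, route NOT born).  The residue line B0–B5 of K2 is now entirely in the tree:

* B1′ `…LocalHelicityLower.localHelicityLower`, B2′ `…LocalDissipationLower.localDissipationLower` (nsreg-p6 g11),
* B3 `…HelicityBudget.helicityBudget` (this seat),
* B5a in class form `…SobolevFatou.sobolevFatou_of_class` (this seat; Di Nezza–Palatucci–Valdinoci via nsreg-typer g15),
* B5b `…EssLocalClass.essLocalClass` (nsreg-p6 g11; ESS 2003 via the tree),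

so the planner's bookkeeping B4 (`HomochiralProfileRigidity_of_B` of `r19/Sketch20v5.lean`) runs with theorems in every
slot:

* `homochiralProfileRigidity` — **support (rank 9) `HomochiralProfileRigidity` of `r19/Sketch20v5.lean`, text verbatim,
  PROVED**: a door-class profile (Type-I time rate `C`, Type-I decay `D`, R19 binder `K`, continuity on the open
  backward slab, unit-viscosity Oseen–Duhamel identity, divergence-free slices) ALL of whose slices are chiral
  (`curl v(t) = Λ v(t)`, Lei–Lin–Zhou's non-local Beltrami condition = vanishing negative helical component) is NOT
  backward-singular at `(0,0)`;
* `homochiralProfileRigidity_noBinder` — the same with the binder dropped (`r19/Sketch20v6.lean` text of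
  `HomochiralProfileRigidity`, verbatim): the binder is a theorem of the class (`…BinderFree`);
* `chiralProfileRigidity_of_sliceAnalytic` — **K2 `ChiralProfileRigidity` (v5 text) FROM the one remaining analytic
  input** `hΛ : Λ(v s)` real-analytic on door-class slices (the spread step, `…ProfileRigidityOfStubs.chiralSpread_of_sliceAnalytic`;
  the input is nsreg-typer g15's `analyticOnNhd_fracLaplacianHalf_of_typeI_ancient_mild`, proposal p561462, Guberović
  2010 tube analyticity + `Λ` preserves tube holomorphy), and `chiralProfileRigidity_noBinder_of_sliceAnalytic` (v6 text);
* `target_of_K1_sliceAnalytic`, `target_of_K1noBinder_sliceAnalytic` — the door `Target` FROM K1 (v5, resp. v6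
  binder-free text) and `hΛ`.

NET: modulo the slice analyticity of `Λ` (a Literature proposal in flight), door S20's open content is K1 alone.

Seat nsreg-p6 g12 (THEOREMS-ONLY door sequels, DIRECTOR-NS g8 #32 (2)/#36); texts by nsreg-p1 g16/g17.  WHAT THIS IS
NOT: not NS regularity (Clay A); not K1 (the local CKN zoom with the non-local chirality functional is untouched); the
residue is a Liouville theorem for a codimension-∞ class of profiles (homochiral), not a statement about general Type-I
blow-up; no route is opened.
-/

noncomputable section

-- the summit and its single sub-problem share the name (CONVENTIONS §1), as in every Theorems file
set_option linter.dupNamespace false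

namespace Summit.NavierStokesRegularity.NavierStokesRegularity.Theorems.ChiralWindowDoorHomochiralProfileRigidity

open MeasureTheory Set Function Filter Topology Metric
open scoped NNReal ENNReal RealInnerProductSpace
open Literature.Analysis Literature.Analysis.FluidPDE
open Summit.NavierStokesRegularity.NavierStokesRegularity.Theorems.ChiralWindowDoorDefs
open Summit.NavierStokesRegularity.NavierStokesRegularity.Theorems.ChiralWindowDoorProfileRigidityOfStubs
  (chiralSpread_of_sliceAnalytic chiralProfileRigidity_of target_of)
open Summit.NavierStokesRegularity.NavierStokesRegularity.Theorems.ChiralWindowDoorLocalHelicityLower (localHelicityLower)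
open Summit.NavierStokesRegularity.NavierStokesRegularity.Theorems.ChiralWindowDoorLocalDissipationLower
  (localDissipationLower)
open Summit.NavierStokesRegularity.NavierStokesRegularity.Theorems.ChiralWindowDoorEssLocalClass (essLocalClass)
open Summit.NavierStokesRegularity.NavierStokesRegularity.Theorems.ChiralWindowDoorBinderFree
  (exists_hasTypeIDerivDecay_of_class)
open Summit.NavierStokesRegularity.NavierStokesRegularity.Theorems.ChiralWindowDoorK1BinderFree
  (localPointZoomChiralWindow_of_noBinder)
open Summit.NavierStokesRegularity.NavierStokesRegularity.Theorems.ChiralWindowDoorSobolevFatou (sobolevFatou_of_class)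
open Summit.NavierStokesRegularity.NavierStokesRegularity.Theorems.ChiralWindowDoorHelicityBudget (helicityBudget)

/-! ### The residue Liouville, everywhere form -/

/-- **Support (rank 9) `HomochiralProfileRigidity` of nsreg-p1 `r19/Sketch20v5.lean` (text verbatim over the tree
substrate), PROVED — homochiral Type-I ancient mild profiles are regular at the apex.**  B4 bookkeeping with every stub a
theorem: from B1′, B2′, B3 and `gagliardo ≥ 0`, `G(a_R, v(t₀)) ≤ c₁ + 2c₂ + c₃` uniformly in `R, t₀`; then B5a (class
form: fractional Sobolev at `R = 2`) and B5b (ESS in the class). -/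
theorem homochiralProfileRigidity :
    ∀ (C D K : ℝ) (v : ℝ → EuclideanSpace ℝ (Fin 3) → EuclideanSpace ℝ (Fin 3)), Literature.Analysis.FluidPDE.HasTypeITimeDecay C v → Literature.Analysis.FluidPDE.HasTypeIDecay D v → HasTypeIDerivDecay K v → ContinuousOn (Function.uncurry v) (Set.Iio (0 : ℝ) ×ˢ Set.univ) → (∀ s t : ℝ, s < t → t < 0 → ∀ x, v t x = Literature.Analysis.UnboundedOperators.heatExtension (v s) (t - s) x - Literature.Analysis.FluidPDE.oseenDuhamel 1 s v v t x) → (∀ t < 0, Literature.Analysis.FluidPDE.VectorCalculus.IsDivFree (v t)) → (∀ t < 0, IsChiral (v t)) → ¬ Literature.Analysis.FluidPDE.IsBackwardSingularPoint v 0 := by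
  intro C D K v hrate hdecay hder hcont hmild hdiv hhom
  obtain ⟨η, hη⟩ := exists_admissibleBump
  obtain ⟨c₁, h₁⟩ := localHelicityLower η hη C D K v hrate hdecay hder hcont hmild hdiv hhom
  obtain ⟨c₂, h₂⟩ := localDissipationLower η hη C D K v hrate hdecay hder hcont hmild hdiv hhom
  obtain ⟨c₃, h₃⟩ := helicityBudget η hη C D K v hrate hdecay hder hcont hmild hdiv
  have hGbound : ∃ c : ℝ, ∀ R > (0 : ℝ), ∀ t₀ < (0 : ℝ), gagliardo (bumpSq η R) (v t₀) ≤ c := by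
    refine ⟨c₁ + 2 * c₂ + c₃, fun R hR t₀ ht₀ => ?_⟩
    have e₁ := h₁ R hR t₀ ht₀
    have e₂ := h₂ R hR t₀ ht₀
    have e₃ := h₃ R hR t₀ ht₀
    have hnn : 0 ≤ ∫ t in Set.Iio t₀, gagliardo (bumpSq η R) (curl (v t)) :=
      setIntegral_nonneg measurableSet_Iio fun t _ => gagliardo_nonneg (bumpSq_nonneg η R) _
    linarith
  have hL3 := sobolevFatou_of_class η hη C D K v hrate hdecay hder hcont hmild hGbound
  exact essLocalClass C D K v hrate hdecay hder hcont hmild hdiv hL3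

/-- **`HomochiralProfileRigidity` of nsreg-p1 `r19/Sketch20v6.lean` (binder-free text, verbatim), PROVED**: the R19
binder is a theorem of the door class. -/
theorem homochiralProfileRigidity_noBinder :
    ∀ (C D : ℝ) (v : ℝ → EuclideanSpace ℝ (Fin 3) → EuclideanSpace ℝ (Fin 3)), Literature.Analysis.FluidPDE.HasTypeITimeDecay C v → Literature.Analysis.FluidPDE.HasTypeIDecay D v → ContinuousOn (Function.uncurry v) (Set.Iio (0 : ℝ) ×ˢ Set.univ) → (∀ s t : ℝ, s < t → t < 0 → ∀ x, v t x = Literature.Analysis.UnboundedOperators.heatExtension (v s) (t - s) x - Literature.Analysis.FluidPDE.oseenDuhamel 1 s v v t x) → (∀ t < 0, Literature.Analysis.FluidPDE.VectorCalculus.IsDivFree (v t)) → (∀ t < 0, Summit.NavierStokesRegularity.NavierStokesRegularity.Theorems.ChiralWindowDoorDefs.IsChiral (v t)) → ¬ Literature.Analysis.FluidPDE.IsBackwardSingularPoint v 0 := by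
  intro C D v hrate hdecay hcont hmild hdiv hhom
  obtain ⟨K, hK⟩ := exists_hasTypeIDerivDecay_of_class hrate hdecay hcont hmild hdiv
  exact homochiralProfileRigidity C D K v hrate hdecay hK hcont hmild hdiv hhom

/-! ### K2 and the door from the one analytic input -/

/-- **K2 `ChiralProfileRigidity` of nsreg-p1 `r19/Sketch20v5.lean` (text verbatim) FROM the real-analyticity of `Λ` on
door-class slices** (the spread step; everything else is a theorem). -/
theorem chiralProfileRigidity_of_sliceAnalytic
    (hΛ : ∀ (C D K : ℝ) (v : ℝ → EuclideanSpace ℝ (Fin 3) → EuclideanSpace ℝ (Fin 3)),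
      HasTypeITimeDecay C v → HasTypeIDecay D v → HasTypeIDerivDecay K v →
      ContinuousOn (Function.uncurry v) (Set.Iio (0 : ℝ) ×ˢ Set.univ) →
      (∀ s t : ℝ, s < t → t < 0 → ∀ x,
          v t x = UnboundedOperators.heatExtension (v s) (t - s) x - oseenDuhamel 1 s v v t x) →
      (∀ t < 0, VectorCalculus.IsDivFree (v t)) →
      ∀ s < (0 : ℝ), AnalyticOnNhd ℝ (fracLapHalf (v s)) univ) :
    ∀ (C D K : ℝ) (v : ℝ → EuclideanSpace ℝ (Fin 3) → EuclideanSpace ℝ (Fin 3)), Literature.Analysis.FluidPDE.HasTypeITimeDecay C v → Literature.Analysis.FluidPDE.HasTypeIDecay D v → HasTypeIDerivDecay K v → ContinuousOn (Function.uncurry v) (Set.Iio (0 : ℝ) ×ˢ Set.univ) → (∀ s t : ℝ, s < t → t < 0 → ∀ x, v t x = Literature.Analysis.UnboundedOperators.heatExtension (v s) (t - s) x - Literature.Analysis.FluidPDE.oseenDuhamel 1 s v v t x) → (∀ t < 0, Literature.Analysis.FluidPDE.VectorCalculus.IsDivFree (v t)) → (∀ s < 0, ∃ U : Set (EuclideanSpace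 ℝ (Fin 3)), IsOpen U ∧ U.Nonempty ∧ ∀ z ∈ U, curl (v s) z = fracLapHalf (v s) z) → ¬ Literature.Analysis.FluidPDE.IsBackwardSingularPoint v 0 :=
  chiralProfileRigidity_of
    (fun C D K v hrate hdecay hder hcont hmild hdiv s hs _U hU hne hUz =>
      chiralSpread_of_sliceAnalytic hrate hcont hmild hs (hΛ C D K v hrate hdecay hder hcont hmild hdiv s hs) hU hne hUz)
    homochiralProfileRigidity

/-- **K2 `ChiralProfileRigidity` of nsreg-p1 `r19/Sketch20v6.lean` (binder-free text, verbatim) FROM the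
real-analyticity of `Λ` on door-class slices.** -/
theorem chiralProfileRigidity_noBinder_of_sliceAnalytic
    (hΛ : ∀ (C D K : ℝ) (v : ℝ → EuclideanSpace ℝ (Fin 3) → EuclideanSpace ℝ (Fin 3)),
      HasTypeITimeDecay C v → HasTypeIDecay D v → HasTypeIDerivDecay K v →
      ContinuousOn (Function.uncurry v) (Set.Iio (0 : ℝ) ×ˢ Set.univ) →
      (∀ s t : ℝ, s < t → t < 0 → ∀ x,
          v t x = UnboundedOperators.heatExtension (v s) (t - s) x - oseenDuhamel 1 s v v t x) →
      (∀ t < 0, VectorCalculus.IsDivFree (v t)) →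
      ∀ s < (0 : ℝ), AnalyticOnNhd ℝ (fracLapHalf (v s)) univ) :
    ∀ (C D : ℝ) (v : ℝ → EuclideanSpace ℝ (Fin 3) → EuclideanSpace ℝ (Fin 3)), Literature.Analysis.FluidPDE.HasTypeITimeDecay C v → Literature.Analysis.FluidPDE.HasTypeIDecay D v → ContinuousOn (Function.uncurry v) (Set.Iio (0 : ℝ) ×ˢ Set.univ) → (∀ s t : ℝ, s < t → t < 0 → ∀ x, v t x = Literature.Analysis.UnboundedOperators.heatExtension (v s) (t - s) x - Literature.Analysis.FluidPDE.oseenDuhamel 1 s v v t x) → (∀ t < 0, Literature.Analysis.FluidPDE.VectorCalculus.IsDivFree (v t)) → (∀ s < 0, ∃ U : Set (EuclideanSpace ℝ (Fin 3)), IsOpen U ∧ U.Nonempty ∧ ∀ z ∈ U, Literature.Analysis.FluidPDE.curl (v s) z = Summit.NavierStokesRegularity.NavierStokesRegularity.Theorems.ChiralWindowDoorDefs.fracLapHalf (v s) z) → ¬ Literature.Analysis.FluidPDE.IsBackwardSingularPoint v 0 := by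
  intro C D v hrate hdecay hcont hmild hdiv hwin
  obtain ⟨K, hK⟩ := exists_hasTypeIDerivDecay_of_class hrate hdecay hcont hmild hdiv
  exact chiralProfileRigidity_of_sliceAnalytic hΛ C D K v hrate hdecay hK hcont hmild hdiv hwin

/-- **The door `Target` of `r19/Sketch20v5.lean` (text verbatim; identical in v6) FROM K1 (v5 text) and the slice
analyticity of `Λ`.** -/
theorem target_of_K1_sliceAnalytic
    (h₁ : ∀ (ν T : ℝ), 0 < ν → 0 < T → ∀ (u : ℝ → EuclideanSpace ℝ (Fin 3) → EuclideanSpace ℝ (Fin 3)) (p : ℝ → EuclideanSpace ℝ (Fin 3) → ℝ), Literature.Analysis.FluidPDE.IsClassicalNSSolutionOn (Set.Ico 0 T) ν 0 u p → Literature.Analysis.FluidPDE.IsLerayHopfOn T ν 0 (u 0) u → Literature.Analysis.FluidPDE.HasRapidSpatialDecay (u 0) → ∀ (x₀ : EuclideanSpace ℝ (Fin 3)) (ρ M : ℝ), 0 < ρ → (∀ t ∈ Set.Ico 0 T, T - ρ ^ 2 < t → ∀ x ∈ Metric.ball x₀ ρ, ‖u t x‖ * (‖x - x₀‖ + Real.sqrt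 (ν * (T - t))) ≤ M) → ∀ (U : Set (EuclideanSpace ℝ (Fin 3))), IsOpen U → U.Nonempty → Filter.Tendsto (fun t => ∫⁻ y in U, ENNReal.ofReal ‖(T - t) • (curl (u t) (x₀ + Real.sqrt (T - t) • y) - fracLapHalf (u t) (x₀ + Real.sqrt (T - t) • y))‖) (nhdsWithin T (Set.Iio T)) (nhds 0) → ¬ Literature.Analysis.FluidPDE.IsBackwardBoundedAt u T x₀ → ∃ (C D K : ℝ) (v : ℝ → EuclideanSpace ℝ (Fin 3) → EuclideanSpace ℝ (Fin 3)), Literature.Analysis.FluidPDE.HasTypeITimeDecay C v ∧ Literature.Analysis.FluidPDE.HasTypeIDecay D v ∧ HasTypeIDerivDecay K v ∧ ContinuousOn (Function.uncurry v) (Set.Iio (0 : ℝ) ×ˢ Set.univ) ∧ (∀ s t : ℝ, s < t → t < 0 → ∀ x, v t x = Literature.Analysis.UnboundedOperators.heatExtension (v s) (t - s) x - Literature.Analysis.FluidPDE.oseenDuhamel 1 s v v t x) ∧ (∀ t < 0, Literature.Analysis.FluidPDE.VectorCalculus.IsDivFree (v t)) ∧ Literature.Analysis.FluidPDE.IsBackwardSingularPoint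 v 0 ∧ (∀ s < 0, ∃ U : Set (EuclideanSpace ℝ (Fin 3)), IsOpen U ∧ U.Nonempty ∧ ∀ z ∈ U, curl (v s) z = fracLapHalf (v s) z))
    (hΛ : ∀ (C D K : ℝ) (v : ℝ → EuclideanSpace ℝ (Fin 3) → EuclideanSpace ℝ (Fin 3)),
      HasTypeITimeDecay C v → HasTypeIDecay D v → HasTypeIDerivDecay K v →
      ContinuousOn (Function.uncurry v) (Set.Iio (0 : ℝ) ×ˢ Set.univ) →
      (∀ s t : ℝ, s < t → t < 0 → ∀ x,
          v t x = UnboundedOperators.heatExtension (v s) (t - s) x - oseenDuhamel 1 s v v t x) →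
      (∀ t < 0, VectorCalculus.IsDivFree (v t)) →
      ∀ s < (0 : ℝ), AnalyticOnNhd ℝ (fracLapHalf (v s)) univ) :
    ∀ (ν T : ℝ), 0 < ν → 0 < T → ∀ (u : ℝ → EuclideanSpace ℝ (Fin 3) → EuclideanSpace ℝ (Fin 3)) (p : ℝ → EuclideanSpace ℝ (Fin 3) → ℝ), Literature.Analysis.FluidPDE.IsClassicalNSSolutionOn (Set.Ico 0 T) ν 0 u p → Literature.Analysis.FluidPDE.IsLerayHopfOn T ν 0 (u 0) u → Literature.Analysis.FluidPDE.HasRapidSpatialDecay (u 0) → ∀ (x₀ : EuclideanSpace ℝ (Fin 3)) (ρ M : ℝ), 0 < ρ → (∀ t ∈ Set.Ico 0 T, T - ρ ^ 2 < t → ∀ x ∈ Metric.ball x₀ ρ, ‖u t x‖ * (‖x - x₀‖ + Real.sqrt (ν * (T - t))) ≤ M) → ∀ (U : Set (EuclideanSpace ℝ (Fin 3))), IsOpen U → U.Nonempty → Filter.Tendsto (fun t => ∫⁻ y in U, ENNReal.ofReal ‖(T - t) • (curl (u t) (x₀ + Real.sqrt (T - t) • y) - fracLapHalf (u t) (x₀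 + Real.sqrt (T - t) • y))‖) (nhdsWithin T (Set.Iio T)) (nhds 0) → Literature.Analysis.FluidPDE.IsBackwardBoundedAt u T x₀ :=
  target_of h₁ (chiralProfileRigidity_of_sliceAnalytic hΛ)

/-- **The door `Target` FROM the binder-free K1 of `r19/Sketch20v6.lean` (text verbatim) and the slice analyticity of
`Λ`.** -/
theorem target_of_K1noBinder_sliceAnalytic
    (h₁ : ∀ (ν T : ℝ), 0 < ν → 0 < T → ∀ (u : ℝ → EuclideanSpace ℝ (Fin 3) → EuclideanSpace ℝ (Fin 3)) (p : ℝ → EuclideanSpace ℝ (Fin 3) → ℝ), Literature.Analysis.FluidPDE.IsClassicalNSSolutionOn (Set.Ico 0 T) ν 0 u p → Literature.Analysis.FluidPDE.IsLerayHopfOn T ν 0 (u 0) u → Literature.Analysis.FluidPDE.HasRapidSpatialDecay (u 0) → ∀ (x₀ : EuclideanSpace ℝ (Fin 3)) (ρ M : ℝ), 0 < ρ → (∀ t ∈ Set.Ico 0 T, T - ρ ^ 2 < t → ∀ x ∈ Metric.ball x₀ ρ, ‖u t x‖ * (‖x - x₀‖ + Real.sqrt (ν * (T - t))) ≤ M)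 → ∀ (U : Set (EuclideanSpace ℝ (Fin 3))), IsOpen U → U.Nonempty → Filter.Tendsto (fun t => ∫⁻ y in U, ENNReal.ofReal ‖(T - t) • (Literature.Analysis.FluidPDE.curl (u t) (x₀ + Real.sqrt (T - t) • y) - Summit.NavierStokesRegularity.NavierStokesRegularity.Theorems.ChiralWindowDoorDefs.fracLapHalf (u t) (x₀ + Real.sqrt (T - t) • y))‖) (nhdsWithin T (Set.Iio T)) (nhds 0) → ¬ Literature.Analysis.FluidPDE.IsBackwardBoundedAt u T x₀ → ∃ (C D : ℝ) (v : ℝ → EuclideanSpace ℝ (Fin 3) → EuclideanSpace ℝ (Fin 3)), Literature.Analysis.FluidPDE.HasTypeITimeDecay C v ∧ Literature.Analysis.FluidPDE.HasTypeIDecay D v ∧ ContinuousOn (Function.uncurry v) (Set.Iio (0 : ℝ) ×ˢ Set.univ) ∧ (∀ s t : ℝ, s < t → t < 0 → ∀ x, v t x = Literature.Analysis.UnboundedOperators.heatExtension (v s) (t - s) x - Literature.Analysis.FluidPDE.oseenDuhamel 1 s v v t x) ∧ (∀ t < 0, Literature.Analysis.FluidPDE.VectorCalculus.IsDivFree (v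 t)) ∧ Literature.Analysis.FluidPDE.IsBackwardSingularPoint v 0 ∧ (∀ s < 0, ∃ U : Set (EuclideanSpace ℝ (Fin 3)), IsOpen U ∧ U.Nonempty ∧ ∀ z ∈ U, Literature.Analysis.FluidPDE.curl (v s) z = Summit.NavierStokesRegularity.NavierStokesRegularity.Theorems.ChiralWindowDoorDefs.fracLapHalf (v s) z))
    (hΛ : ∀ (C D K : ℝ) (v : ℝ → EuclideanSpace ℝ (Fin 3) → EuclideanSpace ℝ (Fin 3)),
      HasTypeITimeDecay C v → HasTypeIDecay D v → HasTypeIDerivDecay K v →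
      ContinuousOn (Function.uncurry v) (Set.Iio (0 : ℝ) ×ˢ Set.univ) →
      (∀ s t : ℝ, s < t → t < 0 → ∀ x,
          v t x = UnboundedOperators.heatExtension (v s) (t - s) x - oseenDuhamel 1 s v v t x) →
      (∀ t < 0, VectorCalculus.IsDivFree (v t)) →
      ∀ s < (0 : ℝ), AnalyticOnNhd ℝ (fracLapHalf (v s)) univ) :
    ∀ (ν T : ℝ), 0 < ν → 0 < T → ∀ (u : ℝ → EuclideanSpace ℝ (Fin 3) → EuclideanSpace ℝ (Fin 3)) (p : ℝ → EuclideanSpace ℝ (Fin 3) → ℝ), Literature.Analysis.FluidPDE.IsClassicalNSSolutionOn (Set.Ico 0 T) ν 0 u p → Literature.Analysis.FluidPDE.IsLerayHopfOn T ν 0 (u 0) u → Literature.Analysis.FluidPDE.HasRapidSpatialDecay (u 0) → ∀ (x₀ : EuclideanSpace ℝ (Fin 3)) (ρ M : ℝ), 0 < ρ → (∀ t ∈ Set.Ico 0 T, T - ρ ^ 2 < t → ∀ x ∈ Metric.ball x₀ ρ, ‖u t x‖ * (‖x - x₀‖ + Real.sqrt (ν * (T - t))) ≤ M) → ∀ (U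 : Set (EuclideanSpace ℝ (Fin 3))), IsOpen U → U.Nonempty → Filter.Tendsto (fun t => ∫⁻ y in U, ENNReal.ofReal ‖(T - t) • (Literature.Analysis.FluidPDE.curl (u t) (x₀ + Real.sqrt (T - t) • y) - Summit.NavierStokesRegularity.NavierStokesRegularity.Theorems.ChiralWindowDoorDefs.fracLapHalf (u t) (x₀ + Real.sqrt (T - t) • y))‖) (nhdsWithin T (Set.Iio T)) (nhds 0) → Literature.Analysis.FluidPDE.IsBackwardBoundedAt u T x₀ :=
  target_of (localPointZoomChiralWindow_of_noBinder h₁) (chiralProfileRigidity_of_sliceAnalytic hΛ)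

end Summit.NavierStokesRegularity.NavierStokesRegularity.Theorems.ChiralWindowDoorHomochiralProfileRigidity

end
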